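import Literature.MathematicalPhysics.QuantumLattice.HubbardFermiSeaTangentRowsDiluteLa214
import Summits.Ventures.CertifiedManyBodySolver.Certificates.HubbardTTPrime_freeGC_kernelQuadrature_b4_tpm1o4_dilute
import Summits.Ventures.CertifiedManyBodySolver.Certificates.HubbardTTPrime_freeGC_kernelQuadrature_b4_tpm3o10_dilute
import Summits.Ventures.CertifiedManyBodySolver.Certificates.HubbardTTPrime_polarizedBandCaps_kernelA
import Summits.Ventures.CertifiedManyBodySolver.Observables.PhaseSeparationExclusionBox
import Summits.Ventures.CertifiedManyBodySolver.Observables.PhaseSeparationExclusionBoxThermalFreeDilute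
import Summits.Ventures.CertifiedManyBodySolver.Observables.PhaseSeparationExclusionMidSegmentCapThermal
import Summits.Ventures.CertifiedManyBodySolver.Observables.PhaseSeparationExclusionMidSegmentCapThermalD
import Summits.Ventures.CertifiedManyBodySolver.Observables.PhaseSeparationExclusionTPrimeStripEXT5
import Summits.Ventures.CertifiedManyBodySolver.Observables.PhaseSeparationExclusionTPrimeStripEXT5LowU
import Summits.Ventures.CertifiedManyBodySolver.Observables.PhaseSeparationExclusionTPrimeStripXUFar
import HarnessLib
import HarnessLib.Audit

/-!
# Ventures/CertifiedManyBodySolver — Observables/PhaseSeparationExclusionNearStripThermalDB.lean: `(≤ 1/4 | ≥ 1)` AT `T > 0` on the La-214 strip segment `t′ ∈ [−3/10, −1/4]` (La₂₋ₓSrₓCuO₄ family La214E ×10, cuprate box CB1)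

HONEST FRAMING: first certified bounds; not a superconductivity verdict. CLASS = DERIVED / CONTEXT (competing-order word, CONTROL class: the excluded partner phase
has hole doping `≥ 3/4`). `T > 0` twins (canonical sector-Gibbs torus limits, `∀ β ≥ β₀`) of the hole-side `(≤ 1/4 | ≥ 1)` ground-state words of hubbard-box-p3
(`Observables/PhaseSeparationExclusion{FarOne*,FarPlanes*,WS597*,TPrimeStrip*}`, psbox v1.10): device = the `T > 0` column law
`psT_not_thermal_mix_on_cell_of_columns_hotAnchorSS_tcap` / `…above_column…` (this seat g25; Israel super-segment convexity + Poulin–Hastings free-entropy allowance +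
Griffiths `U`-monotonicity); CAP per cell = whichever real-parameter cap of the tree gives the lowest threshold — the KERNEL FULLY-POLARISED band caps
(`Certificates/HubbardTTPrime_polarizedBandCaps_kernel*`, hubbard-box-p3 g33: one spin species at density `1/2` or `5/8`, `U`-independent, no claim node), the kernel
Hartree–Fock planes, the registry r468 filling-`1/2` plane, or the registry WITNESS-SPLIT plane of the certified #597 state at filling `3/4` (`wsplit597_cap_tcap_on_cell`,
hubbard-box-p3 g34, claim node `cert_plaqseam_W4split597_TBD_allmk` BY NAME) — named in each docstring; `n = 1` COLUMNS = landed column laws BY NAME (`fy1_*`, `fp_n1_*`,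
K2DIAG `lowU_n1_law*`, EXT5 `ext5_n1_*`, `xu_n1_*`, `far_n1_*`: their producer `n`-sheets `hsX…` (BY VALUE, CANDIDATE class where not referee-replayed), N-tier points `hN…`,
registry nodes `h4xx` and K2DIAG bootstraps `hK…` appear in the signatures verbatim); DILUTE floors = `t′`-chords of the premise-free kernel Fermi-sea tangent rows at the
segment ends; `T > 0` ANCHORS = the kernel free `t–t′` gas at `β* = 4` (`free4_*`; certificates `Certificates/HubbardTTPrime_freeGC_kernelQuadrature_b4_*_dilute`, the
`n₁ = 2/5` editions at `t′ = −11/20, −1/2, −9/20, −7/20` appended this session) and the a-priori `n₂ = 1` anchor `2 log 2` (`apriori_hotCap_halfFilling_on_cell`) — NO thermal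
claim node anywhere. `β₀ = max(β*, ⌈K/M⌉)` per cell from the exact column data printed in each docstring (generator asserts `K < β₀·M` in exact rationals at the corners;
the kernel re-checks by `nlinarith`).

THIS FILE (cells; `β·t ≥ β₀` ⇔ `T ≤ t/(k_B β₀)`): `[133 / 20,71 / 10]` β ≥ 4 (POL_polHalf_m30m20) ∣ `[71 / 10,15 / 2]` β ≥ 4 (POL_polHalf_m30m20) ∣ `[15 / 2,8]` β ≥ 4 (POL_polHalf_m30m20) ∣ `[8,10]` β ≥ 4 (POL_polHalf_m30m20) ∣ `[10,12]` β ≥ 4 (POL_polHalf_m30m20) ∣ `[8,12]` β ≥ 4 (POL_polHalf_m30m20) ∣ `[12,100]` β ≥ 4 (POL_polHalf_m30m20).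
WHY: the `(≤ 2/5 ∣ ≥ 1)` sentence — «no macroscopic mixture of a ≥ 60 %-hole-doped phase with the half-filled-or-denser parent» — is the strongest hole-side word of the
T = 0 table (YBCO M18/M130/M64, Bi2212, CCOC, NdNiO₂, Bi2201, CB1, La-214 boxes) but had a `T > 0` column only on CB1 (β ≥ 14); the other sentences gain lower thresholds where
the WS597 / polarised caps beat the caps of record.
WHAT THIS IS NOT: a certificate or number of record; CONTROL-class words conditional BY NAME / BY VALUE on the premises printed in each signature; canonical sector-Gibbs
torus limits (existence not claimed); nothing about stripes as states, ferromagnetism (a polarised CAP asserts none), superconductivity or `T_c`.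

Seat hubbard-downfold-unc-2 g31 (`prover-hubbard-downfold-unc-2-g31-0`); generator `pub/hubbard-downfold/hubbard-downfold-unc-2/gen-g31/yb/gen31_cells.py` (exact `fractions`;
column-law / cap tables imported read-only from hubbard-box-p3's `work-g33/far1/emit_far1.py` and `work-g34/ws597/{cells597,emit597}.py`).
[cite: Israel1979, Thm. I.2.4] [cite: EmeryKivelsonLin1990, pp. 475–476] [cite: PoulinHastings2011, eqs. (3)–(8)] [cite: Griffiths1966, §II] [cite: Ruelle1969, §3.4] [cite: BachLiebSolovej1994, eq. (2c.36)] [cite: LiebLoss1993, §8, Theorem 8.2]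
-/

noncomputable section

namespace Summit.Ventures.CertifiedManyBodySolver.Observables

open Summit.Ventures.CertifiedManyBodySolver.Certificates Summit.Ventures.CertifiedManyBodySolver.Downfold
open Literature.MathematicalPhysics.QuantumLattice Literature.MathematicalPhysics.QuantumLattice.ThermodynamicLimit
open Literature.MathematicalPhysics.QuantumLattice.InfVolFermionState Set Filter

/-! ## `(≤ 1/4 | ≥ 1)` at `T > 0`, segment D: `t′ ∈ [-3 / 10, -1 / 4]` -/

/-- **FREE-GAS DILUTE ANCHOR at `n₁ = 1/4` on `t′ ∈ [-3/10, -1/4]`, `β* = 4`** (every `U ≥ 0`): the `t′`-chord of the KERNEL ceilings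
`P₀(4, -3/10, -2203/1000) ≤ 110317/250000` and `P₀(4, -1/4, -1131/500) ≤ 244463/500000` (`Certificates/HubbardTTPrime_freeGC_kernelQuadrature_b4_{tpm3o10,tpm1o4}_dilute.lean`) Legendre-shifted to
density `1/4`: `p(4; 1, s, U; 1/4) ≤ chord(2.6442680 @ -3/10, 2.7509260 @ -1/4)`. [cite: Ruelle1969, §3.4] [cite: Israel1979, Thm. I.3.4] -/
theorem free4_1o4_tpm3o10_tpm1o4 {s₁ s₂ U₁ U₂ : ℝ} (hs₁ : -3 / 10 ≤ s₁) (hs₂ : s₂ ≤ -1 / 4) (hU₁ : 0 ≤ U₁) :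
    ∀ s ∈ Icc s₁ s₂, ∀ U ∈ Icc U₁ U₂, pressureTT' (4 : ℝ) 1 s U (1 / 4 : ℝ) ≤
      ((-1 / 4 - s) * ((110317 / 250000 : ℝ) - 4 * (-2203 / 1000) * (1 / 4)) + (s - (-3 / 10)) * ((244463 / 500000 : ℝ) - 4 * (-1131 / 500) * (1 / 4))) /
        (-1 / 4 - (-3 / 10)) := by
  have hA := freeGCPressureTT'_b4_tpm3o10_n1o4_le
  have hB := freeGCPressureTT'_b4_tpm1o4_n1o4_le
  push_cast at hA hB
  exact pressureTT'_le_schord_of_freeGCPressureTT' (βh := 4) (by norm_num) (n := 1 / 4) (by norm_num) (by norm_num)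
    (sa := -3 / 10) (sb := -1 / 4) (by norm_num) hA hB hs₁ hs₂ hU₁

/-- **`(≤ 1/4 | ≥ 1)` at `T > 0` — segment D `t′ ∈ [-3 / 10, -1 / 4]`, columns `U ∈ [133 / 20, 71 / 10]`, EVERY `β ≥ 4`** (`T ≲ 870–1451 K` for `t ∈ [0.30, 0.50] eV`).
Witness filling `1 / 2` (weights `a, b = 2 / 3, 1 / 3`); cap = the PROVED kernel FULLY-POLARISED band cap `polHalf_m30m20` (one spin species at density `1 / 2`, `U`-independent; no claim node); `n = 1` column laws `lowU_n1_law133o20_d30` ∣ `lowU_n1_law71o10_d30` (landed, BY NAME; their producer anchors / registry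
nodes appear in the signature exactly as in the cited law); dilute floor = `t′`-chord of the kernel rows `fermiSeaTangentRow_tPrime_neg_three_div_ten_at_one_div_four` / `fermiSeaTangentRow_tPrime_neg_one_div_four_at_one_div_four`; kernel free-gas dilute anchor
`β* = 4` (`free4_1o4_tpm3o10_tpm1o4`), a-priori `n₂ = 1` anchor `2 log 2` — NO thermal claim node. Exact column data at `s = -3 / 10 ∣ -1 / 4` (`T = 0` margin M, anchored ratio K/M;
`β₀ = max(β*, ⌈K/M⌉)`): `U = 133 / 20`: M 0.1654∣0.1443, K/M 3.44∣3.83; `U = 71 / 10`: M 0.1854∣0.1628, K/M 3.07∣3.40. [cite: Israel1979, Thm. I.2.4] [cite: EmeryKivelsonLin1990, pp. 475–476] [cite: PoulinHastings2011, eqs. (3)–(8)] [cite: Griffiths1966, §II] [cite: Ruelle1969, §3.4] -/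
theorem fpT_1o4_D_133o20to71o10_beta4 (hK29 : cert_laBoxE_K2diag_GU29o5n1tpm3o10_j295889_up) (h21 : cert_r21_luc_tl_upper_n1_U6) (h487 : cert_r487_hubSQ_hanK7R6_U10_r5_e4_so4blk) (h427 : cert_r427_hubSQ_hanK7_U5_r5_e4_so4blk) (h488 : cert_r488_hubSQ_hanK7R6_U6_r5_e4_so4blk) (hsX8m40n1 : ∀ m : ℝ, 0 ≤ m → m < 2 → (((-6924302631376976685514649/1511157274518286468382720 : ℚ)) : ℝ) + (((4407076161681/1099511627776 : ℚ)) : ℝ) * m ≤ energyDensityTT' 1 (-2/5) (8) m) (h428 : cert_r428_hubSQ_hanK7R6_U8_r5_e4_so4blk)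
    {s : ℝ} (hs : s ∈ Icc (-3 / 10 : ℝ) (-1 / 4)) {U : ℝ} (hU : U ∈ Icc (133 / 20 : ℝ) (71 / 10))
    {β : ℝ} (hβ : (4 : ℝ) ≤ β)
    {ω₁ ω₂ : InfVolFermionState 2} (h₁ : ω₁.IsTranslationInvariant) (h₂ : ω₂.IsTranslationInvariant)
    (hρ₁ : 0 < ω₁.density) (hρ₁' : ω₁.density ≤ 1 / 4) (hρ₂ : 1 ≤ ω₂.density) (hρ₂' : ω₂.density < 2)
    {n : ℝ} (hn0 : 0 < n) (hn2 : n < 2) {lam : ℝ} (hl0 : 0 < lam) (hl1 : lam < 1) {Ls : ℕ → ℕ}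
    (hLs : Tendsto Ls atTop atTop) :
    ¬ (mix lam hl0.le hl1.le ω₁ ω₂).IsTorusLimitOfMixture (sectorGibbsCount n) (fun L => sectorGibbsWeightTT' β 1 s U n L)
      (fun L => sectorGibbsVectorTT' 1 s U n L) Ls := by
  refine psT_not_thermal_mix_on_cell_of_columns_hotAnchorSS_tcap 1 (s₁ := -3 / 10) (s₂ := -1 / 4) (U₁ := 133 / 20) (U₂ := 71 / 10)
    (n₁ := 1 / 4) (n₂ := 1) (a := 2 / 3) (b := 1 / 3) (β₀ := 4) (βh₁ := 4) (βh₂ := 0)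
    (c₀ := ((-1601819/2000000 : ℚ) : ℝ)) (cs := ((939347/10000000 : ℚ) : ℝ)) (c₁ := ((0 : ℚ) : ℝ))
    (by norm_num) (by norm_num) (by norm_num) (by norm_num) (by norm_num) (by norm_num) (by norm_num) (by norm_num)
    (by norm_num) (by norm_num) (by norm_num) (by norm_num) hβ (by norm_num)
    (polHalf_m30m20_tcap_on_cell (by norm_num) (by norm_num) (by norm_num) (by norm_num))
    (fun s hs => lowU_n1_law133o20_d30 hK29 h21 h487 h427 h488 hsX8m40n1 h428 s ⟨hs.1.trans' (by norm_num), hs.2.trans (by norm_num)⟩)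
    (fun s hs => lowU_n1_law71o10_d30 hK29 h21 h487 h427 h488 hsX8m40n1 h428 s ⟨hs.1.trans' (by norm_num), hs.2.trans (by norm_num)⟩)
    (fun s hs U hU => floor_on_cell_of_tPrime_end_rows 1 (n := 1 / 4) (by norm_num) (by norm_num) (by norm_num)
      (fun _ hU' => fermiSeaTangentRow_tPrime_neg_three_div_ten_at_one_div_four hU' (by norm_num) (by norm_num)) (fun _ hU' => fermiSeaTangentRow_tPrime_neg_one_div_four_at_one_div_four hU' (by norm_num) (by norm_num)) s hs U (by linarith [hU.1]))
    (free4_1o4_tpm3o10_tpm1o4 (by norm_num) (by norm_num) (by norm_num))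
    (apriori_hotCap_halfFilling_on_cell (by norm_num))
    ?_ ?_ ?_ ?_ hs hU h₁ h₂ hρ₁ hρ₁' hρ₂ hρ₂' hn0 hn2 hl0 hl1 hLs
  · intro s hs; obtain ⟨h1, h2⟩ := hs; push_cast; norm_num; nlinarith [h1, h2]
  · intro s hs; obtain ⟨h1, h2⟩ := hs; push_cast; norm_num; nlinarith [h1, h2]
  · intro s hs; obtain ⟨h1, h2⟩ := hs; push_cast; norm_num; nlinarith [h1, h2]
  · intro s hs; obtain ⟨h1, h2⟩ := hs; push_cast; norm_num; nlinarith [h1, h2]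

/-- **`(≤ 1/4 | ≥ 1)` at `T > 0` — segment D `t′ ∈ [-3 / 10, -1 / 4]`, columns `U ∈ [71 / 10, 15 / 2]`, EVERY `β ≥ 4`** (`T ≲ 870–1451 K` for `t ∈ [0.30, 0.50] eV`).
Witness filling `1 / 2` (weights `a, b = 2 / 3, 1 / 3`); cap = the PROVED kernel FULLY-POLARISED band cap `polHalf_m30m20` (one spin species at density `1 / 2`, `U`-independent; no claim node); `n = 1` column laws `lowU_n1_law71o10_d30` ∣ `lowU_n1_law15o2_d30` (landed, BY NAME; their producer anchors / registry
nodes appear in the signature exactly as in the cited law); dilute floor = `t′`-chord of the kernel rows `fermiSeaTangentRow_tPrime_neg_three_div_ten_at_one_div_four` / `fermiSeaTangentRow_tPrime_neg_one_div_four_at_one_div_four`; kernel free-gas dilute anchor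
`β* = 4` (`free4_1o4_tpm3o10_tpm1o4`), a-priori `n₂ = 1` anchor `2 log 2` — NO thermal claim node. Exact column data at `s = -3 / 10 ∣ -1 / 4` (`T = 0` margin M, anchored ratio K/M;
`β₀ = max(β*, ⌈K/M⌉)`): `U = 71 / 10`: M 0.1854∣0.1628, K/M 3.07∣3.40; `U = 15 / 2`: M 0.2032∣0.1793, K/M 2.80∣3.09. [cite: Israel1979, Thm. I.2.4] [cite: EmeryKivelsonLin1990, pp. 475–476] [cite: PoulinHastings2011, eqs. (3)–(8)] [cite: Griffiths1966, §II] [cite: Ruelle1969, §3.4] -/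
theorem fpT_1o4_D_71o10to15o2_beta4 (hK29 : cert_laBoxE_K2diag_GU29o5n1tpm3o10_j295889_up) (h21 : cert_r21_luc_tl_upper_n1_U6) (h487 : cert_r487_hubSQ_hanK7R6_U10_r5_e4_so4blk) (h427 : cert_r427_hubSQ_hanK7_U5_r5_e4_so4blk) (h488 : cert_r488_hubSQ_hanK7R6_U6_r5_e4_so4blk) (hsX8m40n1 : ∀ m : ℝ, 0 ≤ m → m < 2 → (((-6924302631376976685514649/1511157274518286468382720 : ℚ)) : ℝ) + (((4407076161681/1099511627776 : ℚ)) : ℝ) * m ≤ energyDensityTT' 1 (-2/5) (8) m) (h428 : cert_r428_hubSQ_hanK7R6_U8_r5_e4_so4blk)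
    {s : ℝ} (hs : s ∈ Icc (-3 / 10 : ℝ) (-1 / 4)) {U : ℝ} (hU : U ∈ Icc (71 / 10 : ℝ) (15 / 2))
    {β : ℝ} (hβ : (4 : ℝ) ≤ β)
    {ω₁ ω₂ : InfVolFermionState 2} (h₁ : ω₁.IsTranslationInvariant) (h₂ : ω₂.IsTranslationInvariant)
    (hρ₁ : 0 < ω₁.density) (hρ₁' : ω₁.density ≤ 1 / 4) (hρ₂ : 1 ≤ ω₂.density) (hρ₂' : ω₂.density < 2)
    {n : ℝ} (hn0 : 0 < n) (hn2 : n < 2) {lam : ℝ} (hl0 : 0 < lam) (hl1 : lam < 1) {Ls : ℕ → ℕ}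
    (hLs : Tendsto Ls atTop atTop) :
    ¬ (mix lam hl0.le hl1.le ω₁ ω₂).IsTorusLimitOfMixture (sectorGibbsCount n) (fun L => sectorGibbsWeightTT' β 1 s U n L)
      (fun L => sectorGibbsVectorTT' 1 s U n L) Ls := by
  refine psT_not_thermal_mix_on_cell_of_columns_hotAnchorSS_tcap 1 (s₁ := -3 / 10) (s₂ := -1 / 4) (U₁ := 71 / 10) (U₂ := 15 / 2)
    (n₁ := 1 / 4) (n₂ := 1) (a := 2 / 3) (b := 1 / 3) (β₀ := 4) (βh₁ := 4) (βh₂ := 0)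
    (c₀ := ((-1601819/2000000 : ℚ) : ℝ)) (cs := ((939347/10000000 : ℚ) : ℝ)) (c₁ := ((0 : ℚ) : ℝ))
    (by norm_num) (by norm_num) (by norm_num) (by norm_num) (by norm_num) (by norm_num) (by norm_num) (by norm_num)
    (by norm_num) (by norm_num) (by norm_num) (by norm_num) hβ (by norm_num)
    (polHalf_m30m20_tcap_on_cell (by norm_num) (by norm_num) (by norm_num) (by norm_num))
    (fun s hs => lowU_n1_law71o10_d30 hK29 h21 h487 h427 h488 hsX8m40n1 h428 s ⟨hs.1.trans' (by norm_num), hs.2.trans (by norm_num)⟩)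
    (fun s hs => lowU_n1_law15o2_d30 hK29 h21 h487 h427 h488 hsX8m40n1 h428 s ⟨hs.1.trans' (by norm_num), hs.2.trans (by norm_num)⟩)
    (fun s hs U hU => floor_on_cell_of_tPrime_end_rows 1 (n := 1 / 4) (by norm_num) (by norm_num) (by norm_num)
      (fun _ hU' => fermiSeaTangentRow_tPrime_neg_three_div_ten_at_one_div_four hU' (by norm_num) (by norm_num)) (fun _ hU' => fermiSeaTangentRow_tPrime_neg_one_div_four_at_one_div_four hU' (by norm_num) (by norm_num)) s hs U (by linarith [hU.1]))
    (free4_1o4_tpm3o10_tpm1o4 (by norm_num) (by norm_num) (by norm_num))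
    (apriori_hotCap_halfFilling_on_cell (by norm_num))
    ?_ ?_ ?_ ?_ hs hU h₁ h₂ hρ₁ hρ₁' hρ₂ hρ₂' hn0 hn2 hl0 hl1 hLs
  · intro s hs; obtain ⟨h1, h2⟩ := hs; push_cast; norm_num; nlinarith [h1, h2]
  · intro s hs; obtain ⟨h1, h2⟩ := hs; push_cast; norm_num; nlinarith [h1, h2]
  · intro s hs; obtain ⟨h1, h2⟩ := hs; push_cast; norm_num; nlinarith [h1, h2]
  · intro s hs; obtain ⟨h1, h2⟩ := hs; push_cast; norm_num; nlinarith [h1, h2]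

/-- **`(≤ 1/4 | ≥ 1)` at `T > 0` — segment D `t′ ∈ [-3 / 10, -1 / 4]`, columns `U ∈ [15 / 2, 8]`, EVERY `β ≥ 4`** (`T ≲ 870–1451 K` for `t ∈ [0.30, 0.50] eV`).
Witness filling `1 / 2` (weights `a, b = 2 / 3, 1 / 3`); cap = the PROVED kernel FULLY-POLARISED band cap `polHalf_m30m20` (one spin species at density `1 / 2`, `U`-independent; no claim node); `n = 1` column laws `lowU_n1_law15o2_d30` ∣ `ext5_n1_col8_m40` (landed, BY NAME; their producer anchors / registry
nodes appear in the signature exactly as in the cited law); dilute floor = `t′`-chord of the kernel rows `fermiSeaTangentRow_tPrime_neg_three_div_ten_at_one_div_four` / `fermiSeaTangentRow_tPrime_neg_one_div_four_at_one_div_four`; kernel free-gas dilute anchor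
`β* = 4` (`free4_1o4_tpm3o10_tpm1o4`), a-priori `n₂ = 1` anchor `2 log 2` — NO thermal claim node. Exact column data at `s = -3 / 10 ∣ -1 / 4` (`T = 0` margin M, anchored ratio K/M;
`β₀ = max(β*, ⌈K/M⌉)`): `U = 15 / 2`: M 0.2032∣0.1793, K/M 2.80∣3.09; `U = 8`: M 0.2254∣0.1998, K/M 2.52∣2.77. [cite: Israel1979, Thm. I.2.4] [cite: EmeryKivelsonLin1990, pp. 475–476] [cite: PoulinHastings2011, eqs. (3)–(8)] [cite: Griffiths1966, §II] [cite: Ruelle1969, §3.4] -/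
theorem fpT_1o4_D_15o2to8_beta4 (hK29 : cert_laBoxE_K2diag_GU29o5n1tpm3o10_j295889_up) (h21 : cert_r21_luc_tl_upper_n1_U6) (h487 : cert_r487_hubSQ_hanK7R6_U10_r5_e4_so4blk) (h427 : cert_r427_hubSQ_hanK7_U5_r5_e4_so4blk) (h488 : cert_r488_hubSQ_hanK7R6_U6_r5_e4_so4blk) (hsX8m40n1 : ∀ m : ℝ, 0 ≤ m → m < 2 → (((-6924302631376976685514649/1511157274518286468382720 : ℚ)) : ℝ) + (((4407076161681/1099511627776 : ℚ)) : ℝ) * m ≤ energyDensityTT' 1 (-2/5) (8) m) (h428 : cert_r428_hubSQ_hanK7R6_U8_r5_e4_so4blk)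
    {s : ℝ} (hs : s ∈ Icc (-3 / 10 : ℝ) (-1 / 4)) {U : ℝ} (hU : U ∈ Icc (15 / 2 : ℝ) (8))
    {β : ℝ} (hβ : (4 : ℝ) ≤ β)
    {ω₁ ω₂ : InfVolFermionState 2} (h₁ : ω₁.IsTranslationInvariant) (h₂ : ω₂.IsTranslationInvariant)
    (hρ₁ : 0 < ω₁.density) (hρ₁' : ω₁.density ≤ 1 / 4) (hρ₂ : 1 ≤ ω₂.density) (hρ₂' : ω₂.density < 2)
    {n : ℝ} (hn0 : 0 < n) (hn2 : n < 2) {lam : ℝ} (hl0 : 0 < lam) (hl1 : lam < 1) {Ls : ℕ → ℕ}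
    (hLs : Tendsto Ls atTop atTop) :
    ¬ (mix lam hl0.le hl1.le ω₁ ω₂).IsTorusLimitOfMixture (sectorGibbsCount n) (fun L => sectorGibbsWeightTT' β 1 s U n L)
      (fun L => sectorGibbsVectorTT' 1 s U n L) Ls := by
  refine psT_not_thermal_mix_on_cell_of_columns_hotAnchorSS_tcap 1 (s₁ := -3 / 10) (s₂ := -1 / 4) (U₁ := 15 / 2) (U₂ := 8)
    (n₁ := 1 / 4) (n₂ := 1) (a := 2 / 3) (b := 1 / 3) (β₀ := 4) (βh₁ := 4) (βh₂ := 0)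
    (c₀ := ((-1601819/2000000 : ℚ) : ℝ)) (cs := ((939347/10000000 : ℚ) : ℝ)) (c₁ := ((0 : ℚ) : ℝ))
    (by norm_num) (by norm_num) (by norm_num) (by norm_num) (by norm_num) (by norm_num) (by norm_num) (by norm_num)
    (by norm_num) (by norm_num) (by norm_num) (by norm_num) hβ (by norm_num)
    (polHalf_m30m20_tcap_on_cell (by norm_num) (by norm_num) (by norm_num) (by norm_num))
    (fun s hs => lowU_n1_law15o2_d30 hK29 h21 h487 h427 h488 hsX8m40n1 h428 s ⟨hs.1.trans' (by norm_num), hs.2.trans (by norm_num)⟩)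
    (fun s hs => ext5_n1_col8_m40 hsX8m40n1 h428 s ⟨hs.1.trans' (by norm_num), hs.2.trans (by norm_num)⟩)
    (fun s hs U hU => floor_on_cell_of_tPrime_end_rows 1 (n := 1 / 4) (by norm_num) (by norm_num) (by norm_num)
      (fun _ hU' => fermiSeaTangentRow_tPrime_neg_three_div_ten_at_one_div_four hU' (by norm_num) (by norm_num)) (fun _ hU' => fermiSeaTangentRow_tPrime_neg_one_div_four_at_one_div_four hU' (by norm_num) (by norm_num)) s hs U (by linarith [hU.1]))
    (free4_1o4_tpm3o10_tpm1o4 (by norm_num) (by norm_num) (by norm_num))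
    (apriori_hotCap_halfFilling_on_cell (by norm_num))
    ?_ ?_ ?_ ?_ hs hU h₁ h₂ hρ₁ hρ₁' hρ₂ hρ₂' hn0 hn2 hl0 hl1 hLs
  · intro s hs; obtain ⟨h1, h2⟩ := hs; push_cast; norm_num; nlinarith [h1, h2]
  · intro s hs; obtain ⟨h1, h2⟩ := hs; push_cast; norm_num; nlinarith [h1, h2]
  · intro s hs; obtain ⟨h1, h2⟩ := hs; push_cast; norm_num; nlinarith [h1, h2]
  · intro s hs; obtain ⟨h1, h2⟩ := hs; push_cast; norm_num; nlinarith [h1, h2]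

/-- **`(≤ 1/4 | ≥ 1)` at `T > 0` — segment D `t′ ∈ [-3 / 10, -1 / 4]`, columns `U ∈ [8, 10]`, EVERY `β ≥ 4`** (`T ≲ 870–1451 K` for `t ∈ [0.30, 0.50] eV`).
Witness filling `1 / 2` (weights `a, b = 2 / 3, 1 / 3`); cap = the PROVED kernel FULLY-POLARISED band cap `polHalf_m30m20` (one spin species at density `1 / 2`, `U`-independent; no claim node); `n = 1` column laws `ext5_n1_col8_m40` ∣ `far_n1_law10` (landed, BY NAME; their producer anchors / registry
nodes appear in the signature exactly as in the cited law); dilute floor = `t′`-chord of the kernel rows `fermiSeaTangentRow_tPrime_neg_three_div_ten_at_one_div_four` / `fermiSeaTangentRow_tPrime_neg_one_div_four_at_one_div_four`; kernel free-gas dilute anchor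
`β* = 4` (`free4_1o4_tpm3o10_tpm1o4`), a-priori `n₂ = 1` anchor `2 log 2` — NO thermal claim node. Exact column data at `s = -3 / 10 ∣ -1 / 4` (`T = 0` margin M, anchored ratio K/M;
`β₀ = max(β*, ⌈K/M⌉)`): `U = 8`: M 0.2254∣0.1998, K/M 2.52∣2.77; `U = 10`: M 0.2243∣0.2043, K/M 2.54∣2.71. [cite: Israel1979, Thm. I.2.4] [cite: EmeryKivelsonLin1990, pp. 475–476] [cite: PoulinHastings2011, eqs. (3)–(8)] [cite: Griffiths1966, §II] [cite: Ruelle1969, §3.4] -/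
theorem fpT_1o4_D_8to10_beta4 (hsX8m40n1 : ∀ m : ℝ, 0 ≤ m → m < 2 → (((-6924302631376976685514649/1511157274518286468382720 : ℚ)) : ℝ) + (((4407076161681/1099511627776 : ℚ)) : ℝ) * m ≤ energyDensityTT' 1 (-2/5) (8) m) (h428 : cert_r428_hubSQ_hanK7R6_U8_r5_e4_so4blk) (hN10m35 : ((-236668377/400000000 : ℚ) : ℝ) ≤ energyDensityTT' 1 (-7 / 20) 10 1) (h487 : cert_r487_hubSQ_hanK7R6_U10_r5_e4_so4blk)
    {s : ℝ} (hs : s ∈ Icc (-3 / 10 : ℝ) (-1 / 4)) {U : ℝ} (hU : U ∈ Icc (8 : ℝ) (10))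
    {β : ℝ} (hβ : (4 : ℝ) ≤ β)
    {ω₁ ω₂ : InfVolFermionState 2} (h₁ : ω₁.IsTranslationInvariant) (h₂ : ω₂.IsTranslationInvariant)
    (hρ₁ : 0 < ω₁.density) (hρ₁' : ω₁.density ≤ 1 / 4) (hρ₂ : 1 ≤ ω₂.density) (hρ₂' : ω₂.density < 2)
    {n : ℝ} (hn0 : 0 < n) (hn2 : n < 2) {lam : ℝ} (hl0 : 0 < lam) (hl1 : lam < 1) {Ls : ℕ → ℕ}
    (hLs : Tendsto Ls atTop atTop) :
    ¬ (mix lam hl0.le hl1.le ω₁ ω₂).IsTorusLimitOfMixture (sectorGibbsCount n) (fun L => sectorGibbsWeightTT' β 1 s U n L)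
      (fun L => sectorGibbsVectorTT' 1 s U n L) Ls := by
  refine psT_not_thermal_mix_on_cell_of_columns_hotAnchorSS_tcap 1 (s₁ := -3 / 10) (s₂ := -1 / 4) (U₁ := 8) (U₂ := 10)
    (n₁ := 1 / 4) (n₂ := 1) (a := 2 / 3) (b := 1 / 3) (β₀ := 4) (βh₁ := 4) (βh₂ := 0)
    (c₀ := ((-1601819/2000000 : ℚ) : ℝ)) (cs := ((939347/10000000 : ℚ) : ℝ)) (c₁ := ((0 : ℚ) : ℝ))
    (by norm_num) (by norm_num) (by norm_num) (by norm_num) (by norm_num) (by norm_num) (by norm_num) (by norm_num)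
    (by norm_num) (by norm_num) (by norm_num) (by norm_num) hβ (by norm_num)
    (polHalf_m30m20_tcap_on_cell (by norm_num) (by norm_num) (by norm_num) (by norm_num))
    (fun s hs => ext5_n1_col8_m40 hsX8m40n1 h428 s ⟨hs.1.trans' (by norm_num), hs.2.trans (by norm_num)⟩)
    (fun s hs => far_n1_law10 hN10m35 h487 s ⟨hs.1.trans' (by norm_num), hs.2.trans (by norm_num)⟩)
    (fun s hs U hU => floor_on_cell_of_tPrime_end_rows 1 (n := 1 / 4) (by norm_num) (by norm_num) (by norm_num)
      (fun _ hU' => fermiSeaTangentRow_tPrime_neg_three_div_ten_at_one_div_four hU' (by norm_num) (by norm_num)) (fun _ hU' => fermiSeaTangentRow_tPrime_neg_one_div_four_at_one_div_four hU' (by norm_num) (by norm_num)) s hs U (by linarith [hU.1]))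
    (free4_1o4_tpm3o10_tpm1o4 (by norm_num) (by norm_num) (by norm_num))
    (apriori_hotCap_halfFilling_on_cell (by norm_num))
    ?_ ?_ ?_ ?_ hs hU h₁ h₂ hρ₁ hρ₁' hρ₂ hρ₂' hn0 hn2 hl0 hl1 hLs
  · intro s hs; obtain ⟨h1, h2⟩ := hs; push_cast; norm_num; nlinarith [h1, h2]
  · intro s hs; obtain ⟨h1, h2⟩ := hs; push_cast; norm_num; nlinarith [h1, h2]
  · intro s hs; obtain ⟨h1, h2⟩ := hs; push_cast; norm_num; nlinarith [h1, h2]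
  · intro s hs; obtain ⟨h1, h2⟩ := hs; push_cast; norm_num; nlinarith [h1, h2]

/-- **`(≤ 1/4 | ≥ 1)` at `T > 0` — segment D `t′ ∈ [-3 / 10, -1 / 4]`, columns `U ∈ [10, 12]`, EVERY `β ≥ 4`** (`T ≲ 870–1451 K` for `t ∈ [0.30, 0.50] eV`).
Witness filling `1 / 2` (weights `a, b = 2 / 3, 1 / 3`); cap = the PROVED kernel FULLY-POLARISED band cap `polHalf_m30m20` (one spin species at density `1 / 2`, `U`-independent; no claim node); `n = 1` column laws `far_n1_law10` ∣ `ext5_n1_col12_d30` (landed, BY NAME; their producer anchors / registry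
nodes appear in the signature exactly as in the cited law); dilute floor = `t′`-chord of the kernel rows `fermiSeaTangentRow_tPrime_neg_three_div_ten_at_one_div_four` / `fermiSeaTangentRow_tPrime_neg_one_div_four_at_one_div_four`; kernel free-gas dilute anchor
`β* = 4` (`free4_1o4_tpm3o10_tpm1o4`), a-priori `n₂ = 1` anchor `2 log 2` — NO thermal claim node. Exact column data at `s = -3 / 10 ∣ -1 / 4` (`T = 0` margin M, anchored ratio K/M;
`β₀ = max(β*, ⌈K/M⌉)`): `U = 10`: M 0.2243∣0.2043, K/M 2.54∣2.71; `U = 12`: M 0.2838∣0.2578, K/M 2.00∣2.15. [cite: Israel1979, Thm. I.2.4] [cite: EmeryKivelsonLin1990, pp. 475–476] [cite: PoulinHastings2011, eqs. (3)–(8)] [cite: Griffiths1966, §II] [cite: Ruelle1969, §3.4] -/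
theorem fpT_1o4_D_10to12_beta4 (hN10m35 : ((-236668377/400000000 : ℚ) : ℝ) ≤ energyDensityTT' 1 (-7 / 20) 10 1) (h487 : cert_r487_hubSQ_hanK7R6_U10_r5_e4_so4blk) (hsX12m30n1 : ∀ m : ℝ, 0 ≤ m → m < 2 → (((-42844153095356934828307559/6044629098073145873530880 : ℚ)) : ℝ) + (((3680165511067/549755813888 : ℚ)) : ℝ) * m ≤ energyDensityTT' 1 (-3/10) (12) m) (h489 : cert_r489_hubSQ_hanK7R6_U12_r5_e4_so4blk)
    {s : ℝ} (hs : s ∈ Icc (-3 / 10 : ℝ) (-1 / 4)) {U : ℝ} (hU : U ∈ Icc (10 : ℝ) (12))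
    {β : ℝ} (hβ : (4 : ℝ) ≤ β)
    {ω₁ ω₂ : InfVolFermionState 2} (h₁ : ω₁.IsTranslationInvariant) (h₂ : ω₂.IsTranslationInvariant)
    (hρ₁ : 0 < ω₁.density) (hρ₁' : ω₁.density ≤ 1 / 4) (hρ₂ : 1 ≤ ω₂.density) (hρ₂' : ω₂.density < 2)
    {n : ℝ} (hn0 : 0 < n) (hn2 : n < 2) {lam : ℝ} (hl0 : 0 < lam) (hl1 : lam < 1) {Ls : ℕ → ℕ}
    (hLs : Tendsto Ls atTop atTop) :
    ¬ (mix lam hl0.le hl1.le ω₁ ω₂).IsTorusLimitOfMixture (sectorGibbsCount n) (fun L => sectorGibbsWeightTT' β 1 s U n L)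
      (fun L => sectorGibbsVectorTT' 1 s U n L) Ls := by
  refine psT_not_thermal_mix_on_cell_of_columns_hotAnchorSS_tcap 1 (s₁ := -3 / 10) (s₂ := -1 / 4) (U₁ := 10) (U₂ := 12)
    (n₁ := 1 / 4) (n₂ := 1) (a := 2 / 3) (b := 1 / 3) (β₀ := 4) (βh₁ := 4) (βh₂ := 0)
    (c₀ := ((-1601819/2000000 : ℚ) : ℝ)) (cs := ((939347/10000000 : ℚ) : ℝ)) (c₁ := ((0 : ℚ) : ℝ))
    (by norm_num) (by norm_num) (by norm_num) (by norm_num) (by norm_num) (by norm_num) (by norm_num) (by norm_num)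
    (by norm_num) (by norm_num) (by norm_num) (by norm_num) hβ (by norm_num)
    (polHalf_m30m20_tcap_on_cell (by norm_num) (by norm_num) (by norm_num) (by norm_num))
    (fun s hs => far_n1_law10 hN10m35 h487 s ⟨hs.1.trans' (by norm_num), hs.2.trans (by norm_num)⟩)
    (fun s hs => ext5_n1_col12_d30 hsX12m30n1 h489 s ⟨hs.1.trans' (by norm_num), hs.2.trans (by norm_num)⟩)
    (fun s hs U hU => floor_on_cell_of_tPrime_end_rows 1 (n := 1 / 4) (by norm_num) (by norm_num) (by norm_num)
      (fun _ hU' => fermiSeaTangentRow_tPrime_neg_three_div_ten_at_one_div_four hU' (by norm_num) (by norm_num)) (fun _ hU' => fermiSeaTangentRow_tPrime_neg_one_div_four_at_one_div_four hU' (by norm_num) (by norm_num)) s hs U (by linarith [hU.1]))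
    (free4_1o4_tpm3o10_tpm1o4 (by norm_num) (by norm_num) (by norm_num))
    (apriori_hotCap_halfFilling_on_cell (by norm_num))
    ?_ ?_ ?_ ?_ hs hU h₁ h₂ hρ₁ hρ₁' hρ₂ hρ₂' hn0 hn2 hl0 hl1 hLs
  · intro s hs; obtain ⟨h1, h2⟩ := hs; push_cast; norm_num; nlinarith [h1, h2]
  · intro s hs; obtain ⟨h1, h2⟩ := hs; push_cast; norm_num; nlinarith [h1, h2]
  · intro s hs; obtain ⟨h1, h2⟩ := hs; push_cast; norm_num; nlinarith [h1, h2]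
  · intro s hs; obtain ⟨h1, h2⟩ := hs; push_cast; norm_num; nlinarith [h1, h2]

/-- **`(≤ 1/4 | ≥ 1)` at `T > 0` — segment D `t′ ∈ [-3 / 10, -1 / 4]`, columns `U ∈ [8, 12]`, EVERY `β ≥ 4`** (`T ≲ 870–1451 K` for `t ∈ [0.30, 0.50] eV`).
Witness filling `1 / 2` (weights `a, b = 2 / 3, 1 / 3`); cap = the PROVED kernel FULLY-POLARISED band cap `polHalf_m30m20` (one spin species at density `1 / 2`, `U`-independent; no claim node); `n = 1` column laws `ext5_n1_col8_m40` ∣ `ext5_n1_col12_d30` (landed, BY NAME; their producer anchors / registry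
nodes appear in the signature exactly as in the cited law); dilute floor = `t′`-chord of the kernel rows `fermiSeaTangentRow_tPrime_neg_three_div_ten_at_one_div_four` / `fermiSeaTangentRow_tPrime_neg_one_div_four_at_one_div_four`; kernel free-gas dilute anchor
`β* = 4` (`free4_1o4_tpm3o10_tpm1o4`), a-priori `n₂ = 1` anchor `2 log 2` — NO thermal claim node. Exact column data at `s = -3 / 10 ∣ -1 / 4` (`T = 0` margin M, anchored ratio K/M;
`β₀ = max(β*, ⌈K/M⌉)`): `U = 8`: M 0.2254∣0.1998, K/M 2.52∣2.77; `U = 12`: M 0.2838∣0.2578, K/M 2.00∣2.15. [cite: Israel1979, Thm. I.2.4] [cite: EmeryKivelsonLin1990, pp. 475–476] [cite: PoulinHastings2011, eqs. (3)–(8)] [cite: Griffiths1966, §II] [cite: Ruelle1969, §3.4] -/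
theorem fpT_1o4_D_8to12_beta4 (hsX8m40n1 : ∀ m : ℝ, 0 ≤ m → m < 2 → (((-6924302631376976685514649/1511157274518286468382720 : ℚ)) : ℝ) + (((4407076161681/1099511627776 : ℚ)) : ℝ) * m ≤ energyDensityTT' 1 (-2/5) (8) m) (h428 : cert_r428_hubSQ_hanK7R6_U8_r5_e4_so4blk) (hsX12m30n1 : ∀ m : ℝ, 0 ≤ m → m < 2 → (((-42844153095356934828307559/6044629098073145873530880 : ℚ)) : ℝ) + (((3680165511067/549755813888 : ℚ)) : ℝ) * m ≤ energyDensityTT' 1 (-3/10) (12) m) (h489 : cert_r489_hubSQ_hanK7R6_U12_r5_e4_so4blk)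
    {s : ℝ} (hs : s ∈ Icc (-3 / 10 : ℝ) (-1 / 4)) {U : ℝ} (hU : U ∈ Icc (8 : ℝ) (12))
    {β : ℝ} (hβ : (4 : ℝ) ≤ β)
    {ω₁ ω₂ : InfVolFermionState 2} (h₁ : ω₁.IsTranslationInvariant) (h₂ : ω₂.IsTranslationInvariant)
    (hρ₁ : 0 < ω₁.density) (hρ₁' : ω₁.density ≤ 1 / 4) (hρ₂ : 1 ≤ ω₂.density) (hρ₂' : ω₂.density < 2)
    {n : ℝ} (hn0 : 0 < n) (hn2 : n < 2) {lam : ℝ} (hl0 : 0 < lam) (hl1 : lam < 1) {Ls : ℕ → ℕ}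
    (hLs : Tendsto Ls atTop atTop) :
    ¬ (mix lam hl0.le hl1.le ω₁ ω₂).IsTorusLimitOfMixture (sectorGibbsCount n) (fun L => sectorGibbsWeightTT' β 1 s U n L)
      (fun L => sectorGibbsVectorTT' 1 s U n L) Ls := by
  refine psT_not_thermal_mix_on_cell_of_columns_hotAnchorSS_tcap 1 (s₁ := -3 / 10) (s₂ := -1 / 4) (U₁ := 8) (U₂ := 12)
    (n₁ := 1 / 4) (n₂ := 1) (a := 2 / 3) (b := 1 / 3) (β₀ := 4) (βh₁ := 4) (βh₂ := 0)
    (c₀ := ((-1601819/2000000 : ℚ) : ℝ)) (cs := ((939347/10000000 : ℚ) : ℝ)) (c₁ := ((0 : ℚ) : ℝ))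
    (by norm_num) (by norm_num) (by norm_num) (by norm_num) (by norm_num) (by norm_num) (by norm_num) (by norm_num)
    (by norm_num) (by norm_num) (by norm_num) (by norm_num) hβ (by norm_num)
    (polHalf_m30m20_tcap_on_cell (by norm_num) (by norm_num) (by norm_num) (by norm_num))
    (fun s hs => ext5_n1_col8_m40 hsX8m40n1 h428 s ⟨hs.1.trans' (by norm_num), hs.2.trans (by norm_num)⟩)
    (fun s hs => ext5_n1_col12_d30 hsX12m30n1 h489 s ⟨hs.1.trans' (by norm_num), hs.2.trans (by norm_num)⟩)
    (fun s hs U hU => floor_on_cell_of_tPrime_end_rows 1 (n := 1 / 4) (by norm_num) (by norm_num) (by norm_num)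
      (fun _ hU' => fermiSeaTangentRow_tPrime_neg_three_div_ten_at_one_div_four hU' (by norm_num) (by norm_num)) (fun _ hU' => fermiSeaTangentRow_tPrime_neg_one_div_four_at_one_div_four hU' (by norm_num) (by norm_num)) s hs U (by linarith [hU.1]))
    (free4_1o4_tpm3o10_tpm1o4 (by norm_num) (by norm_num) (by norm_num))
    (apriori_hotCap_halfFilling_on_cell (by norm_num))
    ?_ ?_ ?_ ?_ hs hU h₁ h₂ hρ₁ hρ₁' hρ₂ hρ₂' hn0 hn2 hl0 hl1 hLs
  · intro s hs; obtain ⟨h1, h2⟩ := hs; push_cast; norm_num; nlinarith [h1, h2]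
  · intro s hs; obtain ⟨h1, h2⟩ := hs; push_cast; norm_num; nlinarith [h1, h2]
  · intro s hs; obtain ⟨h1, h2⟩ := hs; push_cast; norm_num; nlinarith [h1, h2]
  · intro s hs; obtain ⟨h1, h2⟩ := hs; push_cast; norm_num; nlinarith [h1, h2]

/-- **`(≤ 1/4 | ≥ 1)` at `T > 0` — segment D `t′ ∈ [-3 / 10, -1 / 4]`, ABOVE the column `U = 12` up to `U = 100`, EVERY `β ≥ 4`** (`T ≲ 870–1451 K`
for `t ∈ [0.30, 0.50] eV`). Witness filling `1 / 2` (`a, b = 2 / 3, 1 / 3`); cap = the PROVED kernel FULLY-POLARISED band cap `polHalf_m30m20` (one spin species at density `1 / 2`, `U`-independent; no claim node); the Griffiths-monotone `n = 1` column law `ext5_n1_col12_d30` at `U = 12` floors every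
larger `U`; dilute rows / free-gas anchor `free4_1o4_tpm3o10_tpm1o4` / a-priori `n₂ = 1` anchor as in the column pieces; law `psT_not_thermal_mix_above_column_hotAnchorSS_tcap`. Far-end data: `U = 100` end (cap slope `c₁ = 0.00000` ≥ 0): M 0.2838∣0.2578, K/M 2.00∣2.15. [cite: Israel1979, Thm. I.2.4] [cite: EmeryKivelsonLin1990, pp. 475–476] [cite: PoulinHastings2011, eqs. (3)–(8)] [cite: Griffiths1966, §II] [cite: Ruelle1969, §3.4] -/
theorem fpT_1o4_D_above12to100_beta4 (hsX12m30n1 : ∀ m : ℝ, 0 ≤ m → m < 2 → (((-42844153095356934828307559/6044629098073145873530880 : ℚ)) : ℝ) + (((3680165511067/549755813888 : ℚ)) : ℝ) * m ≤ energyDensityTT' 1 (-3/10) (12) m) (h489 : cert_r489_hubSQ_hanK7R6_U12_r5_e4_so4blk)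
    {s : ℝ} (hs : s ∈ Icc (-3 / 10 : ℝ) (-1 / 4)) {U : ℝ} (hU : U ∈ Icc (12 : ℝ) (100))
    {β : ℝ} (hβ : (4 : ℝ) ≤ β)
    {ω₁ ω₂ : InfVolFermionState 2} (h₁ : ω₁.IsTranslationInvariant) (h₂ : ω₂.IsTranslationInvariant)
    (hρ₁ : 0 < ω₁.density) (hρ₁' : ω₁.density ≤ 1 / 4) (hρ₂ : 1 ≤ ω₂.density) (hρ₂' : ω₂.density < 2)
    {n : ℝ} (hn0 : 0 < n) (hn2 : n < 2) {lam : ℝ} (hl0 : 0 < lam) (hl1 : lam < 1) {Ls : ℕ → ℕ}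
    (hLs : Tendsto Ls atTop atTop) :
    ¬ (mix lam hl0.le hl1.le ω₁ ω₂).IsTorusLimitOfMixture (sectorGibbsCount n) (fun L => sectorGibbsWeightTT' β 1 s U n L)
      (fun L => sectorGibbsVectorTT' 1 s U n L) Ls := by
  refine psT_not_thermal_mix_above_column_hotAnchorSS_tcap 1 (s₁ := -3 / 10) (s₂ := -1 / 4) (U₂ := 12) (U₃ := 100)
    (n₁ := 1 / 4) (n₂ := 1) (a := 2 / 3) (b := 1 / 3) (β₀ := 4) (βh₁ := 4) (βh₂ := 0)
    (c₀ := ((-1601819/2000000 : ℚ) : ℝ)) (cs := ((939347/10000000 : ℚ) : ℝ)) (c₁ := ((0 : ℚ) : ℝ))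
    (by norm_num) (by norm_num) (by norm_num) (by norm_num) (by norm_num) (by norm_num) (by norm_num) (by norm_num)
    (by norm_num) (by norm_num) (by norm_num) (by norm_num) hβ (by norm_num)
    (polHalf_m30m20_tcap_on_cell (by norm_num) (by norm_num) (by norm_num) (by norm_num))
    (fun s hs => ext5_n1_col12_d30 hsX12m30n1 h489 s ⟨hs.1.trans' (by norm_num), hs.2.trans (by norm_num)⟩)
    (fun s hs U hU => floor_on_cell_of_tPrime_end_rows 1 (n := 1 / 4) (by norm_num) (by norm_num) (by norm_num)
      (fun _ hU' => fermiSeaTangentRow_tPrime_neg_three_div_ten_at_one_div_four hU' (by norm_num) (by norm_num)) (fun _ hU' => fermiSeaTangentRow_tPrime_neg_one_div_four_at_one_div_four hU' (by norm_num) (by norm_num)) s hs U (by linarith [hU.1]))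
    (free4_1o4_tpm3o10_tpm1o4 (by norm_num) (by norm_num) (by norm_num))
    (apriori_hotCap_halfFilling_on_cell (by norm_num))
    ?_ ?_ hs hU h₁ h₂ hρ₁ hρ₁' hρ₂ hρ₂' hn0 hn2 hl0 hl1 hLs
  · intro s hs; obtain ⟨h1, h2⟩ := hs; push_cast; norm_num; nlinarith [h1, h2]
  · intro s hs; obtain ⟨h1, h2⟩ := hs; push_cast; norm_num; nlinarith [h1, h2]

end Summit.Ventures.CertifiedManyBodySolver.Observables

end
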